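import Summits.QuantumFields.YangMills.Theorems.BalabanUVNodesN15KingModelGraphPowerCountingSubgraphs
import Summits.QuantumFields.YangMills.Theorems.BalabanUVNodesN15KingModelGraphPowerCountingKruskalCert

/-!
# BalabanUVNodes ∕ N15 — THE KING-MODEL RUNG (PART Δ-b): **KING's SUBGRAPH CONDITION GIVES (3.77) ALONG EVERY ORDERING, THE MARGIN IS FREE, AND PROPOSITION 3.6
# (3.56) HOLDS FOR CONNECTED GRAPHS «IN WHICH EVERY SUBGRAPH HAS POSITIVE DEGREE» (p. 664, VERBATIM — no ordering, no margin), BY NAME AT `A = 0`**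
# (Track A, DAG node N15 = NE2; FAN-OUT v1.1 §N15 s3 «KING-MODEL RUNG … NE2's analogue DECIDED in the model»)

HONEST FRAMING.  Count-neutral (cell `pub-ymgap`, seat `pub-ymgap-dag-n15-e` g28; `--supports stmt-QuantumFields-27366 --as helper` = K3⁸
`SpineGivenEndpointR13SepCoPHV`).  TEMPLATE LITERATURE: C. King, *The U(1) Higgs model. I. The continuum limit*, Commun. Math. Phys. **102** (1986) 649–677
[King1986], Proposition 3.6 (3.56) p. 662, its proof §3.4 pp. 663–665, §3.5 (3.77) p. 666.  Part Γ-l ★★★ `king_prop36_graph_zeroField_kruskal` proved (3.56) for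
connected graphs under «`PosDegreesBy γ₁ (kingDegList …)` along EVERY ordering» (King's (3.77) with a margin `γ₁ > 0`).  Part Δ-a proved `D(H_i) = Σ_points
D(S_point)` and hence `γ₁ < D(H_i)` from King's ORDERING-FREE sentence «every subgraph has positive degree» (`PosSubgraphsBy γ₁`).  THIS FILE (i) transports that to
the list `kingDegList` (suffix sums of a `List.ofFn` = the prefix degrees `D(H_i)`), (ii) observes that in King's model all exponents are INTEGERS (`dV = d+1`,
`e ∈ {2 − dV, 1 − dV}`), so bare positivity `D > 0` already gives the margin `½` — King's «for γ small enough, D(H_i) − γ are still positive» costs nothing —, and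
(iii) restates Prop. 3.6 twice with NO margin: under (3.77) verbatim (`PosDegrees (kingDegList …)` along every ordering) and under the subgraph condition verbatim
(`PosSubgraphsBy 0`: every non-empty connected sub-line-set has `(d+1)(|V(S)| − 1) + Σ_S e_ℓ > 0`).  King's U(1)∕`A = 0` MODEL; NOT Bałaban's non-abelian `G(U)`
of [B9]; NOT a node discharge; nothing continuum ∕ ℝ⁴ ∕ OS ∕ mass-gap ∕ Clay.  0 `sorry`; standard axioms.
THE PRINT.  p. 664 [PDF 16]: *«In order that this procedure work, it is necessary that every subgraph have positive degree D. … renormalised graphs, in which every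
subgraph has positive degree. We will assume below that this has been done already»*; p. 665 [PDF 17]: *«for γ small enough, the exponents D(H_i) − γ are still
positive, and the bound proceeds as before»*; p. 666 [PDF 18]: *«(i) D(H_i) > 0 for 1 ≤ i ≤ m₁ (3.77)»*.
WHAT THIS FILE PROVES.
* §1 (ns `…Graph`∕`…Curved`, generic): `mem_kruskalTree_iff`, `kingDegList_eq_ofFn` (King's exponent list through `IsTreePos`), `sum_filter_le_comp_rev` (re-indexing
  suffixes by `Fin.rev`), ★ `posDegreesBy_ofFn_of_forall` (suffix sums `> δ` ⇒ `PosDegreesBy δ (List.ofFn h)`), ★ `posDegreesBy_ofFn_rev_of_prefix` (prefix sums),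
  `kingDegList_prefix_eq_prefixDeg`, ★★★ **`posDegreesBy_kingDegList_of_posSubgraphsBy`** (KING's SUBGRAPH CONDITION ⇒ (3.77) WITH THE SAME MARGIN ALONG EVERY ORDERING).
* §2 (the margin is free): `exists_int_list_sum`, ★ `posDegreesBy_of_int` (integer entries: `PosDegrees ⇒ PosDegreesBy δ` for every `δ < 1`), `lineExp_int`,
  `kingDegList_int`, ★★ `posDegreesBy_half_kingDegList` (King's letters: (3.77) verbatim ⇒ margin `½`).
* §3 ★★★ **`king_prop36_graph_zeroField_377`** — Prop. 3.6 (3.56) for connected graphs under (3.77) VERBATIM (`∀ π, PosDegrees (kingDegList src tgt (d+1) (lineExp ∘ κ)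
  π)`), constants `(C₁, C₂, γ₀)` of part Γ-i, rate `γ = min(γ₀, ¼)`, orderings constant `m!·((1 − L^{−¼})^{−1})^m`; ★★★ **`king_prop36_graph_zeroField_subgraphs`** —
  the same under King's p. 664 sentence VERBATIM: `PosSubgraphsBy src tgt 0 (d+1) (lineExp ∘ κ)`.
HONEST SCOPE.  (a) That King's RENORMALISED graphs satisfy the subgraph condition (§3.5 ∕ Theorem 3.5 ∕ [Ba3]: the cancellation of divergences) is NOT typed — it is
now isolated as a finite list of inequalities per graph, one per non-empty connected sub-line-set (part Δ-c lists the elementary census).  (b) Connected graphs;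
`G`∕`∂G` lines; abstract one-vertex factors; (3.56)'s external tree decay not displayed (as parts Γ).  (c) King's U(1)∕`A = 0` model; NOT Bałaban's `G(U)`; NE2∕N15
of record untouched; counts unmoved.  Locators: [King1986] Prop. 3.6 (3.56) p.662, (3.66) p.663 (foot), p.664, p.665, (3.77) p.666.
-/
noncomputable section

namespace Summit.QuantumFields.YangMills.BalabanUVNodes.N15KingModelRung.Graph

open scoped BigOperators
open Finset

/-! ## §1 (generic) Kruskal's tree lines through `IsTreePos`; suffix sums of `List.ofFn` -/

section Generic
variable {nn m : ℕ} {src tgt : Fin m → Fin (nn + 1)}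

/-- the line at position `q` is a Kruskal tree line iff `q` is a tree position. [cite: King1986, (3.66) p.663] -/
theorem mem_kruskalTree_iff {π : Equiv.Perm (Fin m)} {q : Fin m} : π q ∈ kruskalTree src tgt π ↔ IsTreePos src tgt π q := by
  rw [kruskalTree_eq_upTo, mem_kruskalTreeUpTo, Equiv.symm_apply_apply]
  exact ⟨fun h => h.2, fun h => ⟨q.isLt, h⟩⟩

omit src tgt in
/-- re-indexing a suffix `{q ≥ p}` by `Fin.rev`: it becomes the prefix `{q′ < m − p}`. [folklore] -/
theorem sum_filter_le_comp_rev (g : Fin m → ℝ) (p : Fin m) :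
    ∑ q ∈ (univ : Finset (Fin m)).filter (fun q : Fin m => p ≤ q), g (Fin.rev q)
      = ∑ q ∈ (univ : Finset (Fin m)).filter (fun q : Fin m => ((q : ℕ)) < m - p), g q := by
  have himg : ((univ : Finset (Fin m)).filter (fun q : Fin m => p ≤ q)).image Fin.rev
      = (univ : Finset (Fin m)).filter (fun q : Fin m => ((q : ℕ)) < m - p) := by
    ext q
    simp only [mem_image, mem_filter, mem_univ, true_and]
    constructor
    · rintro ⟨r, hr, rfl⟩
      rw [Fin.le_iff_val_le_val] at hr
      rw [Fin.val_rev]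
      omega
    · intro hq
      refine ⟨Fin.rev q, ?_, Fin.rev_rev q⟩
      rw [Fin.le_iff_val_le_val, Fin.val_rev]
      omega
  rw [← himg, sum_image]
  intro x _ y _ h
  exact Fin.rev_injective h

end Generic

end Summit.QuantumFields.YangMills.BalabanUVNodes.N15KingModelRung.Graph

namespace Summit.QuantumFields.YangMills.BalabanUVNodes.N15KingModelRung.Curved

open scoped BigOperators
open Finset
open Literature.MathematicalPhysics.QuantumFieldTheory.Balaban1983to89.B5Prop11Plancherel (Tor fine unitVec)
open Summit.QuantumFields.YangMills.BalabanUVNodes.N15KingModelRung (KingVolIndex kingVol kingVol_neZero)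
open Summit.QuantumFields.YangMills.BalabanUVNodes.N15KingModelRung.Graph

variable {d : ℕ} (L : ℕ) [NeZero L]

section Lists

omit L in
/-- ★ **SUFFIX SUMS `> δ` GIVE `PosDegreesBy δ`** for a `List.ofFn` (part Ι-g's predicate reads the list from the head: the head's partial degree is the total).
[cite: King1986, (3.66) p.664, (3.77) p.666] -/
theorem posDegreesBy_ofFn_of_forall (δ : ℝ) :
    ∀ {n : ℕ} (h : Fin n → ℝ), (∀ p : Fin n, δ < ∑ q ∈ (univ : Finset (Fin n)).filter (fun q : Fin n => p ≤ q), h q) → PosDegreesBy δ (List.ofFn h)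
  | 0, _, _ => by rw [List.ofFn_zero]; trivial
  | n + 1, h, H => by
      rw [List.ofFn_succ]
      refine ⟨?_, ?_⟩
      · -- the total
        have h0 := H 0
        have hall : (univ : Finset (Fin (n + 1))).filter (fun q : Fin (n + 1) => (0 : Fin (n + 1)) ≤ q) = univ :=
          filter_true_of_mem fun q _ => Fin.zero_le q
        rw [hall] at h0
        rw [List.sum_ofFn, ← Fin.sum_univ_succ]
        exact h0
      · -- the tail
        refine posDegreesBy_ofFn_of_forall δ (fun i : Fin n => h i.succ) fun p => ?_
        have hp := H p.succ
        rw [sum_filter, Fin.sum_univ_succ, if_neg (not_le.2 (Fin.succ_pos p)), zero_add] at hp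
        rw [sum_filter]
        refine lt_of_lt_of_eq hp (sum_congr rfl fun i _ => ?_)
        simp only [Fin.succ_le_succ_iff]

omit L in
/-- ★ **PREFIX SUMS `> δ` GIVE `PosDegreesBy δ` FOR THE REVERSED LIST** `List.ofFn (g ∘ Fin.rev)` (coarsest line first, as `orderList`∕`kingDegList`): it suffices that
`δ < Σ_{q < i} g q` for every `1 ≤ i ≤ m`. [cite: King1986, (3.66) p.664, (3.77) p.666] -/
theorem posDegreesBy_ofFn_rev_of_prefix (δ : ℝ) {m : ℕ} (g : Fin m → ℝ)
    (H : ∀ i : ℕ, 1 ≤ i → i ≤ m → δ < ∑ q ∈ (univ : Finset (Fin m)).filter (fun q : Fin m => ((q : ℕ)) < i), g q) :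
    PosDegreesBy δ (List.ofFn fun p : Fin m => g (Fin.rev p)) := by
  refine posDegreesBy_ofFn_of_forall δ (fun p : Fin m => g (Fin.rev p)) fun p => ?_
  rw [sum_filter_le_comp_rev g p]
  exact H (m - p) (by have := p.isLt; omega) (Nat.sub_le m p)

end Lists

/-! ## §1 (continued) King's exponent list through `IsTreePos`; the subgraph condition gives (3.77) along every ordering -/

section KingDegrees
variable {nn m : ℕ} {src tgt : Fin m → Fin (nn + 1)}

omit L in
/-- `kingDegList` written with the tree POSITIONS (part Γ-k `IsTreePos`) in place of membership in Kruskal's tree. [cite: King1986, (3.66) p.663] -/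
theorem kingDegList_eq_ofFn (dV : ℝ) (e : Fin m → ℝ) (π : Equiv.Perm (Fin m)) :
    kingDegList src tgt dV e π = List.ofFn fun p : Fin m => (fun q : Fin m => e (π q) + if IsTreePos src tgt π q then dV else 0) (Fin.rev p) := by
  unfold kingDegList
  simp only [mem_kruskalTree_iff]

omit L in
/-- the prefix sums of King's exponents are the degrees `D(H_i)` of part Δ-a. [cite: King1986, (3.66) p.664] -/
theorem kingDegList_prefix_eq_prefixDeg (dV : ℝ) (e : Fin m → ℝ) (π : Equiv.Perm (Fin m)) (i : ℕ) :
    ∑ q ∈ (univ : Finset (Fin m)).filter (fun q : Fin m => ((q : ℕ)) < i), (e (π q) + if IsTreePos src tgt π q then dV else 0)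
      = prefixDeg src tgt dV e π i := rfl

omit L in
/-- ★★★ **KING's SUBGRAPH CONDITION GIVES (3.77) — WITH THE SAME MARGIN — ALONG EVERY ORDERING**: if every non-empty connected sub-line-set has degree
`dV·(|V(S)| − 1) + Σ_S e_ℓ > γ₁ ≥ 0`, then King's degrees `D(H_i)` along every ordering `π` exceed `γ₁`: `PosDegreesBy γ₁ (kingDegList src tgt dV e π)`.
[cite: King1986, p.664 («every subgraph has positive degree … We will assume below that this has been done already»), (3.77) p.666] -/
theorem posDegreesBy_kingDegList_of_posSubgraphsBy {γ₁ dV : ℝ} {e : Fin m → ℝ} (hγ₁ : 0 ≤ γ₁) (hpos : PosSubgraphsBy src tgt γ₁ dV e)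
    (π : Equiv.Perm (Fin m)) : PosDegreesBy γ₁ (kingDegList src tgt dV e π) := by
  rw [kingDegList_eq_ofFn]
  refine posDegreesBy_ofFn_rev_of_prefix γ₁ (fun q : Fin m => e (π q) + if IsTreePos src tgt π q then dV else 0) fun i hi him => ?_
  rw [kingDegList_prefix_eq_prefixDeg]
  exact lt_prefixDeg_of_posSubgraphsBy hγ₁ hpos π hi (hi.trans him)

end KingDegrees

/-! ## §2 The margin is free: King's exponents are integers -/

section IntegerMargin

omit L in
/-- a list of integer-valued reals has an integer-valued sum. [folklore] -/
theorem exists_int_list_sum : ∀ {es : List ℝ}, (∀ x ∈ es, ∃ z : ℤ, x = (z : ℝ)) → ∃ z : ℤ, es.sum = (z : ℝ)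
  | [], _ => ⟨0, by simp⟩
  | e :: es, h => by
      obtain ⟨z₁, hz₁⟩ := h e (List.mem_cons_self)
      obtain ⟨z₂, hz₂⟩ := exists_int_list_sum (es := es) fun x hx => h x (List.mem_cons_of_mem e hx)
      exact ⟨z₁ + z₂, by rw [List.sum_cons, hz₁, hz₂]; push_cast; ring⟩

omit L in
/-- ★ **FOR INTEGER EXPONENTS THE MARGIN IS FREE**: if every entry is an integer, positivity of the partial degrees gives every margin `δ < 1` (a positive integer
is `≥ 1`) — King's «for γ small enough, the exponents D(H_i) − γ are still positive» at no cost. [cite: King1986, p.665] -/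
theorem posDegreesBy_of_int {δ : ℝ} (hδ : δ < 1) : ∀ {es : List ℝ}, (∀ x ∈ es, ∃ z : ℤ, x = (z : ℝ)) → PosDegrees es → PosDegreesBy δ es
  | [], _, _ => trivial
  | e :: es, hint, h => by
      obtain ⟨h1, h2⟩ := h
      refine ⟨?_, posDegreesBy_of_int hδ (fun x hx => hint x (List.mem_cons_of_mem e hx)) h2⟩
      obtain ⟨z, hz⟩ := exists_int_list_sum (es := e :: es) hint
      rw [List.sum_cons] at hz
      rw [hz] at h1 ⊢
      have hz1 : (1 : ℤ) ≤ z := by exact_mod_cast h1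
      have hz1' : (1 : ℝ) ≤ (z : ℝ) := by exact_mod_cast hz1
      linarith

omit L in
/-- King's line exponents `2 − dV` (`G`) and `1 − dV` (`∂G`) are integers. [cite: King1986, (3.63) p.663] -/
theorem lineExp_int (dd : ℕ) (κ : Option (Fin dd)) : ∃ z : ℤ, lineExp dd κ = (z : ℝ) := by
  cases κ with
  | none => exact ⟨2 - (dd : ℤ), by rw [lineExp_none]; push_cast; ring⟩
  | some μ => exact ⟨1 - (dd : ℤ), by rw [lineExp_some]; push_cast; ring⟩

omit L in
/-- with an integer vertex dimension and integer line exponents, King's exponent list is integer-valued. [cite: King1986, (3.66) p.664] -/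
theorem kingDegList_int {nn m : ℕ} {src tgt : Fin m → Fin (nn + 1)} {dV : ℝ} {e : Fin m → ℝ} (hdV : ∃ z : ℤ, dV = (z : ℝ))
    (he : ∀ ℓ, ∃ z : ℤ, e ℓ = (z : ℝ)) (π : Equiv.Perm (Fin m)) : ∀ x ∈ kingDegList src tgt dV e π, ∃ z : ℤ, x = (z : ℝ) := by
  intro x hx
  unfold kingDegList at hx
  rw [List.mem_ofFn] at hx
  obtain ⟨p, rfl⟩ := hx
  obtain ⟨z₁, hz₁⟩ := he (π (Fin.rev p))
  obtain ⟨z₂, hz₂⟩ := hdV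
  by_cases ht : π (Fin.rev p) ∈ kruskalTree src tgt π
  · exact ⟨z₁ + z₂, by rw [if_pos ht, hz₁, hz₂]; push_cast; ring⟩
  · exact ⟨z₁, by rw [if_neg ht, hz₁, add_zero]⟩

omit L in
/-- ★★ **(3.77) VERBATIM GIVES THE MARGIN `½` IN KING's MODEL**: for lines `G`∕`∂G` in `dd` dimensions (`dV = dd`, `e ∈ {2 − dd, 1 − dd}`), `PosDegrees` of King's
exponent list implies `PosDegreesBy ½`. [cite: King1986, p.665 («for γ small enough … still positive»), (3.77) p.666] -/
theorem posDegreesBy_half_kingDegList {nn m : ℕ} {src tgt : Fin m → Fin (nn + 1)} (dd : ℕ) (κ : Fin m → Option (Fin dd)) (π : Equiv.Perm (Fin m))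
    (h : PosDegrees (kingDegList src tgt ((dd : ℕ) : ℝ) (fun ℓ => lineExp dd (κ ℓ)) π)) :
    PosDegreesBy (1 / 2) (kingDegList src tgt ((dd : ℕ) : ℝ) (fun ℓ => lineExp dd (κ ℓ)) π) :=
  posDegreesBy_of_int (by norm_num) (kingDegList_int ⟨(dd : ℤ), by push_cast; rfl⟩ (fun ℓ => lineExp_int dd (κ ℓ)) π) h

end IntegerMargin

/-! ## §3 Proposition 3.6 (3.56) under (3.77) verbatim, and under King's subgraph condition verbatim -/

section Prop36

/-- ★★★ **KING 1986 PROPOSITION 3.6 (3.56) FOR CONNECTED GRAPHS UNDER (3.77) VERBATIM — NO MARGIN — BY NAME AT `A = 0`**: part Γ-l `king_prop36_graph_zeroField_kruskal`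
with the margin discharged by integrality: for a connected numbered graph it suffices that King's degrees are POSITIVE along every ordering, `∀ π, PosDegrees
(kingDegList src tgt (d+1) (lineExp ∘ κ) π)`; the bound is part Γ-i's with `γ₁ = ½`: rate `L^{−min(γ₀, ¼)·K}`, orderings constant `m!·((1 − L^{−¼})^{−1})^m`.
[cite: King1986, Prop. 3.6 (3.56) p.662, (3.77) p.666, p.665 («for γ small enough»), pp.663–665] -/
theorem king_prop36_graph_zeroField_377 (hLodd : Odd L) (hL : 2 ≤ L) {a : ℝ} (ha : 0 < a) {m0sq : ℝ} (hm0 : 0 ≤ m0sq) :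
    ∃ C₁ C₂ γ₀ : ℝ, 0 < C₁ ∧ 0 < C₂ ∧ 0 < γ₀ ∧ ∀ (msq : ℝ), 0 < msq → msq ≤ m0sq → ∀ (jv : KingVolIndex d) (n : ℕ), 1 ≤ n →
      ∀ (nn m : ℕ) (src tgt : Fin m → Fin (nn + 1)), (∀ v, LConn src tgt univ 0 v) →
      ∀ (κ : Fin m → Option (Fin (d + 1))) (Υ : Type) [Fintype Υ] [DecidableEq Υ]
        (vtx : Υ → Fin (nn + 1)) (υ₀ : Υ), vtx υ₀ = 0 →
        haveI := kingVol_neZero L jv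
        ∀ (u : Υ → Tor (fine (L ^ jv.K) (kingVol L jv)) → ℝ) (u' : Υ → Tor (fine (L ^ (jv.K + n)) (kingVol L jv)) → ℝ)
          (qq s : Υ → ℝ) (p₀ r₀ : Tor (fine (L ^ jv.K) (kingVol L jv)) → ℝ) (Γ Γ' : ℝ),
          (∀ υ, 0 ≤ qq υ) → (∀ υ, 0 ≤ s υ) → (∀ x, 0 ≤ r₀ x) →
          (∀ υ, υ ≠ υ₀ → ∀ x, |u υ x| ≤ qq υ) → (∀ υ, υ ≠ υ₀ → ∀ x', |u' υ x'| ≤ qq υ) →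
          (∀ υ, υ ≠ υ₀ → ∀ x', |u' υ x' - u υ (kingSlicePt L jv.K n (kingVol L jv) x')| ≤ s υ * qq υ) →
          (∀ x, |u υ₀ x| ≤ p₀ x) → (∀ x', |u' υ₀ x'| ≤ p₀ (kingSlicePt L jv.K n (kingVol L jv) x')) →
          (∀ x', |u' υ₀ x' - u υ₀ (kingSlicePt L jv.K n (kingVol L jv) x')| ≤ r₀ (kingSlicePt L jv.K n (kingVol L jv) x')) →
          (∑ x, (((L : ℝ) ^ jv.K)⁻¹) ^ (d + 1) * p₀ x ≤ Γ) → (∑ x, (((L : ℝ) ^ jv.K)⁻¹) ^ (d + 1) * r₀ x ≤ Γ') →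
          (∀ π : Equiv.Perm (Fin m), PosDegrees (kingDegList src tgt ((d + 1 : ℕ) : ℝ) (fun ℓ => lineExp (d + 1) (κ ℓ)) π)) →
            |graphValLS ((((L : ℝ) ^ (jv.K + n))⁻¹) ^ (d + 1)) src tgt (fun ℓ => kingGLine L (kingVol L jv) a msq (jv.K + n) (κ ℓ)) vtx u'
                - graphValLS ((((L : ℝ) ^ jv.K)⁻¹) ^ (d + 1)) src tgt (fun ℓ => kingGLine L (kingVol L jv) a msq jv.K (κ ℓ)) vtx u|
              ≤ (Γ' + Γ * ((L : ℝ) ^ (-(min γ₀ (1 / 4) * jv.K)) * (m + 1) + ∑ υ ∈ univ.erase υ₀, s υ))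
                * (C₁ ^ m * C₂ ^ nn * ((m.factorial : ℝ) * ((1 - (L : ℝ) ^ (-(1 / 4 : ℝ)))⁻¹) ^ m) * ∏ υ ∈ univ.erase υ₀, qq υ) := by
  obtain ⟨C₁, C₂, γ₀, hC₁, hC₂, hγ₀, H⟩ := king_prop36_graph_zeroField_kruskal (d := d) L hLodd hL ha hm0
  refine ⟨C₁, C₂, γ₀, hC₁, hC₂, hγ₀, fun msq hm hcap jv n hn nn m src tgt hconn κ Υ _ _ vtx υ₀ hυ₀ u u' qq s p₀ r₀ Γ Γ'
    hqq hs hr₀ hu hu' hus hp₀ hp₀' hr₀' hΓ hΓ' h377 => ?_⟩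
  have key := H msq hm hcap jv n hn nn m src tgt hconn κ Υ vtx υ₀ hυ₀ u u' qq s p₀ r₀ Γ Γ' (1 / 2) hqq hs hr₀ hu hu' hus hp₀ hp₀' hr₀' hΓ hΓ'
    one_half_pos fun π => posDegreesBy_half_kingDegList (d + 1) κ π (h377 π)
  have e4 : (1 / 2 : ℝ) / 2 = 1 / 4 := by norm_num
  rw [e4] at key
  exact key

/-- ★★★ **KING 1986 PROPOSITION 3.6 (3.56) FOR CONNECTED GRAPHS «IN WHICH EVERY SUBGRAPH HAS POSITIVE DEGREE» (p. 664, VERBATIM), BY NAME AT `A = 0`** — the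
hypothesis is ORDERING-FREE and WITHOUT MARGIN: every non-empty connected sub-line-set `S` has `(d+1)·(|V(S)| − 1) + Σ_{ℓ∈S} e_ℓ > 0` (`e = 2 − (d+1)` for `G`,
`1 − (d+1)` for `∂G`), i.e. `PosSubgraphsBy src tgt 0 (d+1) (lineExp ∘ κ)`; then (3.77) holds along every ordering (part Δ-a∕§1), the margin `½` is free (§2),
and part Γ-l gives the bound with rate `L^{−min(γ₀, ¼)·K}`.  What §3.5∕[Ba3] must supply for King's renormalised graphs is exactly this finite list of
inequalities. [cite: King1986, Prop. 3.6 (3.56) p.662, p.664 («every subgraph has positive degree»), (3.77) p.666, pp.663–665] -/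
theorem king_prop36_graph_zeroField_subgraphs (hLodd : Odd L) (hL : 2 ≤ L) {a : ℝ} (ha : 0 < a) {m0sq : ℝ} (hm0 : 0 ≤ m0sq) :
    ∃ C₁ C₂ γ₀ : ℝ, 0 < C₁ ∧ 0 < C₂ ∧ 0 < γ₀ ∧ ∀ (msq : ℝ), 0 < msq → msq ≤ m0sq → ∀ (jv : KingVolIndex d) (n : ℕ), 1 ≤ n →
      ∀ (nn m : ℕ) (src tgt : Fin m → Fin (nn + 1)), (∀ v, LConn src tgt univ 0 v) →
      ∀ (κ : Fin m → Option (Fin (d + 1))), PosSubgraphsBy src tgt 0 ((d + 1 : ℕ) : ℝ) (fun ℓ => lineExp (d + 1) (κ ℓ)) →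
      ∀ (Υ : Type) [Fintype Υ] [DecidableEq Υ]
        (vtx : Υ → Fin (nn + 1)) (υ₀ : Υ), vtx υ₀ = 0 →
        haveI := kingVol_neZero L jv
        ∀ (u : Υ → Tor (fine (L ^ jv.K) (kingVol L jv)) → ℝ) (u' : Υ → Tor (fine (L ^ (jv.K + n)) (kingVol L jv)) → ℝ)
          (qq s : Υ → ℝ) (p₀ r₀ : Tor (fine (L ^ jv.K) (kingVol L jv)) → ℝ) (Γ Γ' : ℝ),
          (∀ υ, 0 ≤ qq υ) → (∀ υ, 0 ≤ s υ) → (∀ x, 0 ≤ r₀ x) →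
          (∀ υ, υ ≠ υ₀ → ∀ x, |u υ x| ≤ qq υ) → (∀ υ, υ ≠ υ₀ → ∀ x', |u' υ x'| ≤ qq υ) →
          (∀ υ, υ ≠ υ₀ → ∀ x', |u' υ x' - u υ (kingSlicePt L jv.K n (kingVol L jv) x')| ≤ s υ * qq υ) →
          (∀ x, |u υ₀ x| ≤ p₀ x) → (∀ x', |u' υ₀ x'| ≤ p₀ (kingSlicePt L jv.K n (kingVol L jv) x')) →
          (∀ x', |u' υ₀ x' - u υ₀ (kingSlicePt L jv.K n (kingVol L jv) x')| ≤ r₀ (kingSlicePt L jv.K n (kingVol L jv) x')) →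
          (∑ x, (((L : ℝ) ^ jv.K)⁻¹) ^ (d + 1) * p₀ x ≤ Γ) → (∑ x, (((L : ℝ) ^ jv.K)⁻¹) ^ (d + 1) * r₀ x ≤ Γ') →
            |graphValLS ((((L : ℝ) ^ (jv.K + n))⁻¹) ^ (d + 1)) src tgt (fun ℓ => kingGLine L (kingVol L jv) a msq (jv.K + n) (κ ℓ)) vtx u'
                - graphValLS ((((L : ℝ) ^ jv.K)⁻¹) ^ (d + 1)) src tgt (fun ℓ => kingGLine L (kingVol L jv) a msq jv.K (κ ℓ)) vtx u|
              ≤ (Γ' + Γ * ((L : ℝ) ^ (-(min γ₀ (1 / 4) * jv.K)) * (m + 1) + ∑ υ ∈ univ.erase υ₀, s υ))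
                * (C₁ ^ m * C₂ ^ nn * ((m.factorial : ℝ) * ((1 - (L : ℝ) ^ (-(1 / 4 : ℝ)))⁻¹) ^ m) * ∏ υ ∈ univ.erase υ₀, qq υ) := by
  obtain ⟨C₁, C₂, γ₀, hC₁, hC₂, hγ₀, H⟩ := king_prop36_graph_zeroField_377 (d := d) L hLodd hL ha hm0
  refine ⟨C₁, C₂, γ₀, hC₁, hC₂, hγ₀, fun msq hm hcap jv n hn nn m src tgt hconn κ hsub Υ _ _ vtx υ₀ hυ₀ u u' qq s p₀ r₀ Γ Γ'
    hqq hs hr₀ hu hu' hus hp₀ hp₀' hr₀' hΓ hΓ' => ?_⟩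
  exact H msq hm hcap jv n hn nn m src tgt hconn κ Υ vtx υ₀ hυ₀ u u' qq s p₀ r₀ Γ Γ' hqq hs hr₀ hu hu' hus hp₀ hp₀' hr₀' hΓ hΓ'
    fun π => posDegrees_of_posDegreesBy le_rfl (posDegreesBy_kingDegList_of_posSubgraphsBy le_rfl hsub π)

end Prop36

end Summit.QuantumFields.YangMills.BalabanUVNodes.N15KingModelRung.Curved

end
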